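import Literature.Combinatorics.SimpleGraph.HamiltonianPortGadget
import HarnessLib

/-!
# Swapping the middle block of a Hamiltonian path

List surgery for local replacement in Hamiltonian-path counts (Garey–Johnson 1979, §3.2.2),
used by the three-port vertex gadget identity (`HamiltonianPortGadgetCount.lean`): a Hamiltonian
path `P ++ m₁ ++ S` whose outer blocks `P`, `S` live in the host `V` and whose middle block `m₁`
lives outside `V` stays Hamiltonian when `m₁` is replaced by another block `m₂` outside `V` that
is internally a path and fits the two seams — for instance a gadget traversal `m₁ = xs ⊆ VT`
replaced by the single base vertex `m₂ = [τ]`, or conversely.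

* `splice τ w l` — replace the entry `τ` of `l` by the list `w`; `splice_eq`;
* `isHamPathOn_swap` — the swap lemma; `uses_swap_iff` — edges inside `V` are used by
  `P ++ m₂ ++ S` iff by `P ++ m₁ ++ S`; `toFinset_outer_eq` — the outer blocks cover exactly the
  host part of the vertex set;
* `entry_eq`, `exit_eq` — in `l₁ ++ u :: (xs ++ v :: l₂)` with `l₁, u, v, l₂` in the host and
  `xs ≠ []` outside, the only host-to-outside step is `u, xs.head` and the only outside-to-host
  step is `xs.last, v`.

## References

* M. R. Garey, D. S. Johnson, *Computers and Intractability*, Freeman 1979, §3.2.2.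
-/

namespace Literature.Combinatorics.SimpleGraph

variable {α : Type*} [DecidableEq α]

/-! ### Splicing a list in place of an entry -/

/-- **Splice**: replace every occurrence of `τ` in `l` by the list `w` (used when `τ` occurs
exactly once). [cite: GareyJohnson1979, §3.2.2 (local replacement)] -/
def splice (τ : α) (w l : List α) : List α :=
  l.flatMap fun d => if d = τ then w else [d]

/-- Splicing does nothing to a list avoiding `τ`. [folklore] -/
theorem splice_of_not_mem (τ : α) (w : List α) {l : List α} (h : τ ∉ l) : splice τ w l = l := by
  induction l with
  | nil => rfl
  | cons d l ih =>
    have hd : d ≠ τ := fun hd => h (hd ▸ List.mem_cons_self)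
    have hl : τ ∉ l := fun hl => h (List.mem_cons_of_mem _ hl)
    unfold splice at ih ⊢
    rw [List.flatMap_cons, if_neg hd, ih hl, List.singleton_append]

/-- **Splicing at the unique occurrence**: `splice τ w (L ++ τ :: R) = L ++ w ++ R` when `τ`
occurs neither in `L` nor in `R`. [folklore] -/
theorem splice_eq (τ : α) (w : List α) {L R : List α} (hL : τ ∉ L) (hR : τ ∉ R) :
    splice τ w (L ++ τ :: R) = L ++ w ++ R := by
  have h1 := splice_of_not_mem τ w hL
  have h2 := splice_of_not_mem τ w hR
  unfold splice at h1 h2 ⊢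
  rw [List.flatMap_append, List.flatMap_cons, if_pos rfl, h1, h2, List.append_assoc]

/-! ### Chains on the host -/

omit [DecidableEq α] in
/-- Two graphs that agree on `V` have the same chains inside `V`. [folklore] -/
theorem isChain_congr_of_agree {G₁ G₂ : _root_.SimpleGraph α} {V : Finset α}
    (hagree : ∀ v ∈ V, ∀ w ∈ V, (G₁.Adj v w ↔ G₂.Adj v w)) {L : List α} (hL : ∀ d ∈ L, d ∈ V) :
    List.IsChain G₁.Adj L ↔ List.IsChain G₂.Adj L := by
  rw [List.IsChain.iff_mem, List.IsChain.iff_mem (R := G₂.Adj)]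
  exact ⟨fun h => h.imp fun a b ⟨ha, hb, hab⟩ => ⟨ha, hb, (hagree a (hL a ha) b (hL b hb)).1 hab⟩,
    fun h => h.imp fun a b ⟨ha, hb, hab⟩ => ⟨ha, hb, (hagree a (hL a ha) b (hL b hb)).2 hab⟩⟩

/-! ### The swap lemma -/

section swap

variable {G₁ G₂ : _root_.SimpleGraph α} {V : Finset α} {P S m₁ m₂ : List α} {W₁ : Finset α}
  {s t : α}

/-- The outer blocks of a Hamiltonian path starting and ending in the host are nonempty.
[folklore] -/
theorem outer_ne_nil (hm₁V : ∀ d ∈ m₁, d ∉ V) (hm₁ : m₁ ≠ [])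
    (h₁ : IsHamPathOn G₁ W₁ s t (P ++ m₁ ++ S)) (hs : s ∈ V) (ht : t ∈ V) : P ≠ [] ∧ S ≠ [] := by
  obtain ⟨d, m, rfl⟩ := List.exists_cons_of_ne_nil hm₁
  constructor
  · rintro rfl
    have := h₁.2.2.1
    simp only [List.nil_append, List.cons_append, List.head?_cons, Option.some.injEq] at this
    exact hm₁V d List.mem_cons_self (this ▸ hs)
  · rintro rfl
    have := h₁.2.2.2.1
    rw [List.append_nil, List.getLast?_append, List.getLast?_cons] at this
    have hmem : t ∈ d :: m := by
      have h' : (d :: m).getLast? = some t := by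
        cases hm : m.getLast? with
        | none =>
          rw [List.getLast?_eq_none_iff] at hm
          subst hm
          simpa using this
        | some e =>
          rw [hm] at this
          simp only [Option.getD_some, Option.some_or, Option.some.injEq] at this
          subst this
          rw [List.getLast?_cons, hm]; rfl
      exact List.mem_of_getLast? h'
    exact hm₁V t hmem ht

/-- **The swap lemma.** Let `G₁`, `G₂` agree on `V`; let `P ++ m₁ ++ S` be a Hamiltonian `s`–`t`
path of `G₁` (`s, t ∈ V`) with `P, S` inside `V` and `m₁ ≠ []` outside `V`; let `m₂ ≠ []` be a
list outside `V` without repeats which is a chain of `G₂` and fits the seams (`P.last – m₂.head`,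
`m₂.last – S.head` are edges of `G₂`). Then `P ++ m₂ ++ S` is a Hamiltonian `s`–`t` path of `G₂`
through the host part together with the vertices of `m₂`.
[cite: GareyJohnson1979, §3.2.2 (local replacement)] -/
theorem isHamPathOn_swap (hagree : ∀ v ∈ V, ∀ w ∈ V, (G₁.Adj v w ↔ G₂.Adj v w))
    (hP : ∀ d ∈ P, d ∈ V) (hS : ∀ d ∈ S, d ∈ V) (hm₁V : ∀ d ∈ m₁, d ∉ V) (hm₂V : ∀ d ∈ m₂, d ∉ V)
    (hm₁ : m₁ ≠ []) (hm₂ : m₂ ≠ []) (hnd₂ : m₂.Nodup) (hc₂ : List.IsChain G₂.Adj m₂)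
    (hseam₁ : ∀ p ∈ P.getLast?, ∀ q ∈ m₂.head?, G₂.Adj p q)
    (hseam₂ : ∀ p ∈ m₂.getLast?, ∀ q ∈ S.head?, G₂.Adj p q)
    (h₁ : IsHamPathOn G₁ W₁ s t (P ++ m₁ ++ S)) (hs : s ∈ V) (ht : t ∈ V) :
    IsHamPathOn G₂ ((P ++ S).toFinset ∪ m₂.toFinset) s t (P ++ m₂ ++ S) := by
  obtain ⟨hPne, hSne⟩ := outer_ne_nil hm₁V hm₁ h₁ hs ht
  obtain ⟨hnd, -, hh, hl, hc⟩ := h₁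
  -- no repeats
  rw [List.nodup_append', List.nodup_append'] at hnd
  obtain ⟨⟨hndP, -, -⟩, hndS, hdisj⟩ := hnd
  have hdisPS : List.Disjoint P S := fun d hdP hdS => hdisj (List.mem_append_left _ hdP) hdS
  refine ⟨?_, ?_, ?_, ?_, ?_⟩
  · rw [List.nodup_append', List.nodup_append']
    refine ⟨⟨hndP, hnd₂, fun d hdP hdm => hm₂V d hdm (hP d hdP)⟩, hndS, fun d hd hdS => ?_⟩
    rcases List.mem_append.1 hd with hdP | hdm
    · exact hdisPS hdP hdS
    · exact hm₂V d hdm (hS d hdS)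
  · ext d
    simp only [List.toFinset_append, Finset.mem_union, List.mem_toFinset]
    tauto
  · rw [List.append_assoc, List.head?_append_of_ne_nil _ hPne] at hh ⊢
    exact hh
  · rw [List.getLast?_append_of_ne_nil _ hSne] at hl ⊢
    exact hl
  · -- chains: outer blocks from `h₁`, middle block and seams by hypothesis
    have hcP : List.IsChain G₂.Adj P :=
      (isChain_congr_of_agree hagree hP).1 (hc.left_of_append.left_of_append)
    have hcS : List.IsChain G₂.Adj S := (isChain_congr_of_agree hagree hS).1 hc.right_of_append
    rw [List.isChain_append, List.isChain_append]
    exact ⟨⟨hcP, hc₂, hseam₁⟩, hcS, fun p hp q hq => by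
      rw [List.getLast?_append_of_ne_nil _ hm₂] at hp
      exact hseam₂ p hp q hq⟩

omit [DecidableEq α] in
/-- **Edges inside the host are used by `P ++ m ++ S` independently of the middle block `m`**
(nonempty, outside the host). [folklore] -/
theorem uses_middle_iff {m : List α}
    (hmV : ∀ d ∈ m, d ∉ V) (hm : m ≠ []) {e : α × α} (he : e.1 ∈ V ∧ e.2 ∈ V) :
    Uses (P ++ m ++ S) e ↔ ([e.1, e.2] <:+: P ∨ [e.1, e.2] <:+: S) ∨ ([e.2, e.1] <:+: P ∨ [e.2, e.1] <:+: S) := by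
  have h1 : e.1 ∉ m := fun h => hmV _ h he.1
  have h2 : e.2 ∉ m := fun h => hmV _ h he.2
  unfold Uses
  rw [pair_infix_middle_iff hm h1 h2, pair_infix_middle_iff hm h2 h1]

omit [DecidableEq α] in
/-- **Swapping the middle block keeps the used host edges.** [folklore] -/
theorem uses_swap_iff (hm₁V : ∀ d ∈ m₁, d ∉ V)
    (hm₂V : ∀ d ∈ m₂, d ∉ V) (hm₁ : m₁ ≠ []) (hm₂ : m₂ ≠ []) {e : α × α} (he : e.1 ∈ V ∧ e.2 ∈ V) :
    Uses (P ++ m₂ ++ S) e ↔ Uses (P ++ m₁ ++ S) e := by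
  rw [uses_middle_iff (P := P) (S := S) hm₂V hm₂ he, uses_middle_iff hm₁V hm₁ he]

/-- **The outer blocks cover exactly the host part**: if `P ++ m₁ ++ S` is Hamiltonian through
`V ∪ X` with `P, S ⊆ V`, `m₁` outside `V` and `m₁.toFinset = X`, then `(P ++ S).toFinset = V`.
[folklore] -/
theorem toFinset_outer_eq {X : Finset α} (hP : ∀ d ∈ P, d ∈ V) (hS : ∀ d ∈ S, d ∈ V)
    (hX : Disjoint V X) (hm₁X : m₁.toFinset = X)
    (h₁ : IsHamPathOn G₁ (V ∪ X) s t (P ++ m₁ ++ S)) : (P ++ S).toFinset = V := by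
  have hW := h₁.2.1
  ext d
  simp only [List.toFinset_append, Finset.mem_union, List.mem_toFinset]
  constructor
  · rintro (hd | hd)
    exacts [hP d hd, hS d hd]
  · intro hdV
    have hd : d ∈ (P ++ m₁ ++ S).toFinset := by rw [hW]; exact Finset.mem_union_left _ hdV
    simp only [List.toFinset_append, Finset.mem_union, List.mem_toFinset] at hd
    rcases hd with (hd | hd) | hd
    · exact Or.inl hd
    · exact absurd (hm₁X ▸ List.mem_toFinset.2 hd) (Finset.disjoint_left.1 hX hdV)
    · exact Or.inr hd

end swap

/-! ### The host-to-gadget step and the gadget-to-host step are unique -/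

section entry

variable {VX : Finset α} {l₁ l₂ xs : List α} {u v p q : α}

omit [DecidableEq α] in
/-- **Entry uniqueness**: in `l₁ ++ u :: (xs ++ v :: l₂)` with `l₁, u, v, l₂` outside `VX` and
`xs ≠ []` inside, a consecutive pair `p ∉ VX`, `q ∈ VX` is `u, xs.head`. [folklore] -/
theorem entry_eq (hl₁ : ∀ d ∈ l₁, d ∉ VX) (hl₂ : ∀ d ∈ l₂, d ∉ VX) (hu : u ∉ VX) (hv : v ∉ VX)
    (hxs : ∀ d ∈ xs, d ∈ VX) (hp : p ∉ VX) (hq : q ∈ VX)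
    (hinf : [p, q] <:+: l₁ ++ u :: (xs ++ v :: l₂)) : p = u ∧ xs.head? = some q := by
  rcases pair_infix_append_iff.1 hinf with h | h | ⟨-, h₂⟩
  · exact absurd hq (hl₁ q (mem_of_pair_infix h).2)
  · rcases pair_infix_cons_iff.1 h with ⟨rfl, hh⟩ | h
    · refine ⟨rfl, ?_⟩
      rcases xs with _ | ⟨w, ws⟩
      · simp only [List.nil_append, List.head?_cons, Option.some.injEq] at hh
        exact absurd (hh ▸ hq) hv
      · simpa using hh
    · rcases pair_infix_append_iff.1 h with h | h | ⟨h₁, -⟩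
      · exact absurd (hxs p (mem_of_pair_infix h).1) hp
      · rcases pair_infix_cons_iff.1 h with ⟨rfl, hh⟩ | h
        · exact absurd hq (hl₂ q (List.mem_of_mem_head? hh))
        · exact absurd hq (hl₂ q (mem_of_pair_infix h).2)
      · exact absurd (hxs p (List.mem_of_getLast? h₁)) hp
  · simp only [List.head?_cons, Option.some.injEq] at h₂
    exact absurd (h₂ ▸ hq) hu

omit [DecidableEq α] in
/-- **Exit uniqueness**: a consecutive pair `q ∈ VX`, `p ∉ VX` is `xs.last, v`. [folklore] -/
theorem exit_eq (hl₁ : ∀ d ∈ l₁, d ∉ VX) (hl₂ : ∀ d ∈ l₂, d ∉ VX) (hu : u ∉ VX) (hv : v ∉ VX)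
    (hxs : ∀ d ∈ xs, d ∈ VX) (hp : p ∉ VX) (hq : q ∈ VX)
    (hinf : [q, p] <:+: l₁ ++ u :: (xs ++ v :: l₂)) : p = v ∧ xs.getLast? = some q := by
  have hrev : [p, q] <:+: l₂.reverse ++ v :: (xs.reverse ++ u :: l₁.reverse) := by
    have := List.reverse_infix.2 hinf
    simpa using this
  obtain ⟨rfl, hh⟩ := entry_eq (VX := VX) (fun d hd => hl₂ d (List.mem_reverse.1 hd))
    (fun d hd => hl₁ d (List.mem_reverse.1 hd)) hv hu (fun d hd => hxs d (List.mem_reverse.1 hd))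
    hp hq hrev
  exact ⟨rfl, by rwa [List.head?_reverse] at hh⟩

end entry

end Literature.Combinatorics.SimpleGraph
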